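import Summits.Ventures.PercRepro.ProfilePointedCircuitClassesInOutTriangleIV

/-!
# PercRepro — THE «BOTTOM ≤ TOP − 2» COMPARISON `(G)` IN THE DUAL: A RANK-`3` DOUBLE COUNTING
(p5, gen 39; `proofs/P5-GM1.md` §55)

`(G)` (`MixedPairBottomTopTwo`, InOutTriangleIV) compares, on a nullity-`3` matroid `M` marked by an independent
pair `T = {f, g}`, the `3`-subsets `Y` of `H₀ := E − T` with `Y ∈ ℐ` and `(H₀ − Y) ∪ T ∈ ℐ` against those with
`Y ∪ T ∈ ℐ` and `H₀ − Y ∈ ℐ`.  In the dual `R := M✶` — a LOOPLESS matroid of RANK `3` on the same points, in which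
`X ∈ ℐ(M)` reads «`E − X` spans `R`» — the two families are
`𝓛 = {Y : Y spans R ∧ (H₀ − Y) ∪ T spans R}` and `𝓤 = {Y : Y ∪ T spans R ∧ H₀ − Y spans R}`.
This module proves `#𝓛 ≤ #𝓤` for every loopless rank-`3` matroid `R` on `≥ 9` points with `H₀` spanning
(`mixedPair_dual_core`); the transfer to `(G)` itself is the next module.

THE PROOF (a single global double counting, replacing the per-flat case analysis of §54 ADDENDUM 7).  Both
families contain the bi-spanning triples `𝓑 = {Y : Y spans ∧ H₀ − Y spans}`; it remains to compare
`𝒟′ = 𝓛 − 𝓑` (`Y` spans, `W := H₀ − Y` does not, `W ∪ T` spans) with `𝒰′ = 𝓤 − 𝓑` (`Z` does not span, `Z ∪ T`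
spans, `H₀ − Z` spans).  Relate `Y ∈ 𝒟′` to the `3`-subsets `Z ⊆ W` with `ρ(Z) = ρ(W)`: every such `Z` lies in
`𝒰′` (`ρ(Z ∪ T) = 3` by submodularity against `W`, `H₀ − Z ⊇ Y` spans), and with `m := #W = #E − 5 ≥ 4`
* every `Y` has at least `C(m − 1, 2)` of them (`choose_le_card_filter_rk_eq`: in a rank-`≤ 2` set of `m` points,
  at least `C(m − 1, 2)` triples have the full rank — the triples through a point `w₀`, with the pairs parallel
  to `w₀` re-routed through a point `v₀ ∉ cl{w₀}`);
* every `Z` has at most `C(m − 1, 2)` of them (`Y ↦ Y − o₀` is injective into the pairs of `H₀ − Z − o₀`, for a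
  point `o₀ ∈ H₀ − cl(Z)`, which every such `Y` contains because `H₀ − Y ⊆ cl(Z)`).
`Finset.card_mul_le_card_mul` then gives `#𝒟′ ≤ #𝒰′`.
-/

open scoped Matroid

namespace PercRepro.Cogirth

open Finset ThmH Skew Shadow Profile

variable {α : Type} [DecidableEq α] {R : Matroid α} [R.Finite]

section Triples

omit [DecidableEq α] in
/-- In a loopless matroid a nonempty subset of the ground set has rank `≥ 1`. -/
theorem one_le_rk_of_mem_of_loopless (hll : ∀ x ∈ gr R, rk R {x} = 1) {X : Finset α} (hX : X ⊆ gr R)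
    {x : α} (hx : x ∈ X) : 1 ≤ rk R X := by
  have h1 := hll x (hX hx)
  have h2 := rk_mono' (M := R) (singleton_subset_iff.2 hx)
  omega

/-- **THE TRIPLES LEMMA**: in a loopless matroid, a set `W` of `m ≥ 3` points of rank `≤ 2` has at least
`C(m − 1, 2)` three-point subsets of its own rank. -/
theorem choose_le_card_filter_rk_eq (hll : ∀ x ∈ gr R, rk R {x} = 1) {W : Finset α} (hW : W ⊆ gr R)
    (h3 : 3 ≤ W.card) (hr : rk R W ≤ 2) :
    (W.card - 1).choose 2 ≤ ((W.powersetCard 3).filter (fun Z => rk R Z = rk R W)).card := by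
  obtain ⟨w₀, hw₀⟩ : W.Nonempty := card_pos.1 (by omega)
  have hrW1 : 1 ≤ rk R W := one_le_rk_of_mem_of_loopless hll hW hw₀
  rcases Nat.lt_or_ge (rk R W) 2 with h1 | h2
  · -- rank `1`: every triple has rank `1`
    have hall : (W.powersetCard 3).filter (fun Z => rk R Z = rk R W) = W.powersetCard 3 := by
      apply filter_true_of_mem
      intro Z hZ
      rw [mem_powersetCard] at hZ
      have hle := rk_mono' (M := R) hZ.1
      obtain ⟨z, hz⟩ : Z.Nonempty := card_pos.1 (by omega)
      have hge := one_le_rk_of_mem_of_loopless hll (hZ.1.trans hW) hz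
      omega
    rw [hall, card_powersetCard]
    obtain ⟨k, hk⟩ : ∃ k, W.card = k + 1 := ⟨W.card - 1, by omega⟩
    rw [hk, Nat.choose_succ_succ', Nat.add_sub_cancel]
    omega
  · -- rank `2`
    have hrW : rk R W = 2 := by omega
    have hw₀E : w₀ ∈ gr R := hW hw₀
    have hrw₀ : rk R {w₀} = 1 := hll w₀ hw₀E
    -- a point `v₀ ∈ W` not parallel to `w₀`
    obtain ⟨v₀, hv₀W, hv₀⟩ : ∃ v₀ ∈ W, rk R (insert v₀ {w₀}) = 2 := by
      by_contra hcon
      simp only [not_exists, not_and] at hcon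
      have hsub : W ⊆ clF R {w₀} := by
        intro x hx
        rw [mem_clF_iff_rk_insert (hW hx) (singleton_subset_iff.2 hw₀E)]
        have h1 := hcon x hx
        have h2 : rk R (insert x {w₀}) ≤ 2 := by
          have := rk_le_card (M := R) (insert x {w₀})
          have := card_insert_le x ({w₀} : Finset α)
          rw [card_singleton] at this
          omega
        have h3 := rk_mono' (M := R) (subset_insert x ({w₀} : Finset α))
        omega
      have := rk_mono' (M := R) hsub
      rw [rk_clF] at this
      omega
    have hv₀w₀ : v₀ ≠ w₀ := by
      rintro rfl
      rw [insert_eq_of_mem (mem_singleton_self v₀)] at hv₀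
      omega
    -- the pairs of `W − w₀`: through `w₀` when the triple has rank `2`, through `v₀` otherwise
    have hA : ∀ S ∈ ((W.erase w₀).powersetCard 2).filter (fun S => rk R (insert w₀ S) = 2),
        insert w₀ S ∈ (W.powersetCard 3).filter (fun Z => rk R Z = rk R W) := by
      intro S hS
      rw [mem_filter, mem_powersetCard] at hS
      obtain ⟨⟨hSW, hS2⟩, hSr⟩ := hS
      have hw₀S : w₀ ∉ S := fun h => (mem_erase.1 (hSW h)).1 rfl
      rw [mem_filter, mem_powersetCard, card_insert_of_notMem hw₀S, hS2, hrW]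
      exact ⟨⟨insert_subset hw₀ (hSW.trans (erase_subset _ _)), rfl⟩, hSr⟩
    have hB : ∀ S ∈ ((W.erase w₀).powersetCard 2).filter (fun S => ¬ rk R (insert w₀ S) = 2),
        insert v₀ S ∈ (W.powersetCard 3).filter (fun Z => rk R Z = rk R W) ∧ v₀ ∉ S := by
      intro S hS
      rw [mem_filter, mem_powersetCard] at hS
      obtain ⟨⟨hSW, hS2⟩, hSr⟩ := hS
      have hSW' : S ⊆ W := hSW.trans (erase_subset _ _)
      have hw₀S : w₀ ∉ S := fun h => (mem_erase.1 (hSW h)).1 rfl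
      -- `insert w₀ S` has rank `1`
      have hr1 : rk R (insert w₀ S) = 1 := by
        have hle := rk_mono' (M := R) (insert_subset hw₀ hSW')
        have hge := rk_mono' (M := R) (singleton_subset_iff.2 (mem_insert_self w₀ S))
        omega
      have hv₀S : v₀ ∉ S := by
        intro h
        have := rk_mono' (M := R) (insert_subset (mem_insert_of_mem h) (singleton_subset_iff.2 (mem_insert_self w₀ S)))
        omega
      -- `insert v₀ S` has rank `2`: submodularity against `insert w₀ S`
      have hsub := rk_inter_add_rk_union_le' (M := R) (insert w₀ S) (insert v₀ S)
      obtain ⟨s, hs⟩ : S.Nonempty := card_pos.1 (by omega)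
      have hi : 1 ≤ rk R (insert w₀ S ∩ insert v₀ S) :=
        one_le_rk_of_mem_of_loopless hll (inter_subset_left.trans (insert_subset hw₀ hSW' |>.trans hW))
          (mem_inter.2 ⟨mem_insert_of_mem hs, mem_insert_of_mem hs⟩)
      have hu : 2 ≤ rk R (insert w₀ S ∪ insert v₀ S) := by
        rw [← hv₀]
        apply rk_mono'
        exact insert_subset (mem_union_right _ (mem_insert_self v₀ S))
          (singleton_subset_iff.2 (mem_union_left _ (mem_insert_self w₀ S)))
      have hle2 := rk_mono' (M := R) (insert_subset hv₀W hSW')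
      refine ⟨?_, hv₀S⟩
      rw [mem_filter, mem_powersetCard, card_insert_of_notMem hv₀S, hS2, hrW]
      exact ⟨⟨insert_subset hv₀W hSW', rfl⟩, by omega⟩
    -- the two images are disjoint and injective
    have hcard : ((W.erase w₀).powersetCard 2).card =
        (((W.erase w₀).powersetCard 2).filter (fun S => rk R (insert w₀ S) = 2)).card +
        (((W.erase w₀).powersetCard 2).filter (fun S => ¬ rk R (insert w₀ S) = 2)).card :=
      (card_filter_add_card_filter_not _).symm
    have hinjA : Set.InjOn (fun S => insert w₀ S)
        (((W.erase w₀).powersetCard 2).filter (fun S => rk R (insert w₀ S) = 2) : Set (Finset α)) := by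
      intro S₁ hS₁ S₂ hS₂ h
      simp only [coe_filter, Set.mem_setOf_eq, mem_powersetCard] at hS₁ hS₂
      have h₁ : w₀ ∉ S₁ := fun h' => (mem_erase.1 (hS₁.1.1 h')).1 rfl
      have h₂ : w₀ ∉ S₂ := fun h' => (mem_erase.1 (hS₂.1.1 h')).1 rfl
      have := congrArg (fun Z => Z.erase w₀) h
      simpa only [erase_insert h₁, erase_insert h₂] using this
    have hinjB : Set.InjOn (fun S => insert v₀ S)
        (((W.erase w₀).powersetCard 2).filter (fun S => ¬ rk R (insert w₀ S) = 2) : Set (Finset α)) := by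
      intro S₁ hS₁ S₂ hS₂ h
      have h₁ := (hB S₁ (by simpa only [coe_filter, Set.mem_setOf_eq, mem_filter] using hS₁)).2
      have h₂ := (hB S₂ (by simpa only [coe_filter, Set.mem_setOf_eq, mem_filter] using hS₂)).2
      have := congrArg (fun Z => Z.erase v₀) h
      simpa only [erase_insert h₁, erase_insert h₂] using this
    have hdisj : Disjoint
        ((((W.erase w₀).powersetCard 2).filter (fun S => rk R (insert w₀ S) = 2)).image (fun S => insert w₀ S))
        ((((W.erase w₀).powersetCard 2).filter (fun S => ¬ rk R (insert w₀ S) = 2)).image (fun S => insert v₀ S)) := by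
      rw [disjoint_left]
      intro Z hZ₁ hZ₂
      rw [mem_image] at hZ₁ hZ₂
      obtain ⟨S₁, _, rfl⟩ := hZ₁
      obtain ⟨S₂, hS₂, hZ⟩ := hZ₂
      have hw₀S₂ : w₀ ∉ S₂ := fun h => (mem_erase.1 ((mem_powersetCard.1 (mem_filter.1 hS₂).1).1 h)).1 rfl
      have : w₀ ∈ insert v₀ S₂ := by rw [hZ]; exact mem_insert_self _ _
      rw [mem_insert] at this
      rcases this with h | h
      · exact hv₀w₀ h.symm
      · exact hw₀S₂ h
    have hunion : ((((W.erase w₀).powersetCard 2).filter (fun S => rk R (insert w₀ S) = 2)).image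
          (fun S => insert w₀ S)) ∪
        ((((W.erase w₀).powersetCard 2).filter (fun S => ¬ rk R (insert w₀ S) = 2)).image
          (fun S => insert v₀ S)) ⊆ (W.powersetCard 3).filter (fun Z => rk R Z = rk R W) := by
      intro Z hZ
      rw [mem_union, mem_image, mem_image] at hZ
      rcases hZ with ⟨S, hS, rfl⟩ | ⟨S, hS, rfl⟩
      · exact hA S hS
      · exact (hB S hS).1
    calc (W.card - 1).choose 2 = ((W.erase w₀).powersetCard 2).card := by
          rw [card_powersetCard, card_erase_of_mem hw₀]
      _ = _ := hcard
      _ = ((((W.erase w₀).powersetCard 2).filter (fun S => rk R (insert w₀ S) = 2)).image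
            (fun S => insert w₀ S)).card +
          ((((W.erase w₀).powersetCard 2).filter (fun S => ¬ rk R (insert w₀ S) = 2)).image
            (fun S => insert v₀ S)).card := by
          rw [card_image_of_injOn hinjA, card_image_of_injOn hinjB]
      _ = _ := (card_union_of_disjoint hdisj).symm
      _ ≤ _ := card_le_card hunion

end Triples

section Core

variable {f g : α}

/-- **THE CHILDREN**: for `Y ∈ 𝒟′` (`Y` spans, `W = H₀ − Y` does not, `W ∪ T` spans), every `3`-subset `Z` of
`W` with `ρ(Z) = ρ(W)` lies in `𝒰′` (`Z` does not span, `Z ∪ T` spans, `H₀ − Z` spans). -/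
theorem mem_units_of_subset_of_rk_eq (hR3 : rk R (gr R) = 3) {H₀ : Finset α} (hH₀ : H₀ ⊆ gr R)
    (hT : ({f, g} : Finset α) ⊆ gr R) {Y Z : Finset α} (hY : Y ⊆ H₀) (hYr : rk R Y = 3)
    (hWT : rk R (H₀ \ Y ∪ {f, g}) = 3) (hW : ¬ rk R (H₀ \ Y) = 3) (hZ : Z ⊆ H₀ \ Y) (hZ3 : Z.card = 3)
    (hZr : rk R Z = rk R (H₀ \ Y)) :
    Z ∈ (H₀.powersetCard 3).filter (fun Y => rk R (Y ∪ {f, g}) = 3 ∧ rk R (H₀ \ Y) = 3) ∧ ¬ rk R Z = 3 := by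
  have hle3 : ∀ X ⊆ gr R, rk R X ≤ 3 := fun X hX => hR3 ▸ rk_mono' hX
  have hZH : Z ⊆ H₀ := hZ.trans sdiff_subset
  refine ⟨?_, by omega⟩
  rw [mem_filter, mem_powersetCard]
  refine ⟨⟨hZH, hZ3⟩, ?_, ?_⟩
  · -- `ρ(Z ∪ T) = 3` by submodularity against `W`
    have hsub := rk_inter_add_rk_union_le' (M := R) (Z ∪ {f, g}) (H₀ \ Y)
    have hi : rk R Z ≤ rk R ((Z ∪ {f, g}) ∩ (H₀ \ Y)) :=
      rk_mono' (subset_inter subset_union_left hZ)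
    have hu : rk R (H₀ \ Y ∪ {f, g}) ≤ rk R ((Z ∪ {f, g}) ∪ (H₀ \ Y)) :=
      rk_mono' (union_subset subset_union_right (subset_union_right.trans subset_union_left))
    have hle := hle3 (Z ∪ {f, g}) (union_subset (hZH.trans hH₀) hT)
    omega
  · -- `H₀ − Z ⊇ Y` spans
    have hYZ : Y ⊆ H₀ \ Z := by
      intro y hy
      rw [mem_sdiff]
      exact ⟨hY hy, fun hz => (mem_sdiff.1 (hZ hz)).2 hy⟩
    have h1 := rk_mono' (M := R) hYZ
    have h2 := hle3 (H₀ \ Z) (sdiff_subset.trans hH₀)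
    omega

/-- **THE PARENTS**: for `Z ∈ 𝒰′` and a point `o₀ ∈ H₀ − cl(Z)`, every `Y ∈ 𝒟′` with `Z ⊆ H₀ − Y` and
`ρ(Z) = ρ(H₀ − Y)` contains `o₀` (because `H₀ − Y ⊆ cl(Z)`). -/
theorem mem_of_parent {H₀ : Finset α} (hH₀ : H₀ ⊆ gr R) {Y Z : Finset α}
    (hZ : Z ⊆ H₀ \ Y) (hZr : rk R Z = rk R (H₀ \ Y)) {o₀ : α} (ho₀ : o₀ ∈ H₀) (hcl : o₀ ∉ clF R Z) :
    o₀ ∈ Y := by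
  by_contra ho
  apply hcl
  rw [mem_clF_iff_rk_insert (hH₀ ho₀) ((hZ.trans sdiff_subset).trans hH₀)]
  have h1 : rk R (insert o₀ Z) ≤ rk R (H₀ \ Y) :=
    rk_mono' (insert_subset (mem_sdiff.2 ⟨ho₀, ho⟩) hZ)
  have h2 := rk_mono' (M := R) (subset_insert o₀ Z)
  omega

/-- **`#𝓛 ≤ #𝓤` IN THE DUAL**: on a loopless matroid `R` of rank `3` on `≥ 9` points with a pair `f ≠ g` whose
complement `H₀ = E − f − g` spans, the `3`-subsets `Y` of `H₀` with `Y` and `(H₀ − Y) ∪ {f, g}` both spanning are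
at most those with `Y ∪ {f, g}` and `H₀ − Y` both spanning. -/
theorem mixedPair_dual_core (hR3 : rk R (gr R) = 3) (hll : ∀ x ∈ gr R, rk R {x} = 1)
    (hf : f ∈ gr R) (hg : g ∈ gr R) (hfg : f ≠ g)
    (hH : rk R (((gr R).erase f).erase g) = 3) (h9 : 9 ≤ (gr R).card) :
    (((((gr R).erase f).erase g).powersetCard 3).filter (fun Y =>
        rk R Y = 3 ∧ rk R (((gr R).erase f).erase g \ Y ∪ {f, g}) = 3)).card ≤
    (((((gr R).erase f).erase g).powersetCard 3).filter (fun Y =>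
        rk R (Y ∪ {f, g}) = 3 ∧ rk R (((gr R).erase f).erase g \ Y) = 3)).card := by
  obtain ⟨H₀, hH₀⟩ : ∃ H₀, H₀ = ((gr R).erase f).erase g := ⟨_, rfl⟩
  rw [← hH₀] at hH ⊢
  have hH₀E : H₀ ⊆ gr R := by rw [hH₀]; exact (erase_subset _ _).trans (erase_subset _ _)
  have hcardH₀ : H₀.card + 2 = (gr R).card := by
    rw [hH₀, card_erase_of_mem (mem_erase.2 ⟨hfg.symm, hg⟩), card_erase_of_mem hf]
    have := card_pos.2 ⟨f, hf⟩
    have : 1 ≤ ((gr R).erase f).card := card_pos.2 ⟨g, mem_erase.2 ⟨hfg.symm, hg⟩⟩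
    rw [card_erase_of_mem hf] at this
    omega
  have hT : ({f, g} : Finset α) ⊆ gr R := insert_subset hf (singleton_subset_iff.2 hg)
  have hle3 : ∀ X ⊆ gr R, rk R X ≤ 3 := fun X hX => hR3 ▸ rk_mono' hX
  obtain ⟨m, hm⟩ : ∃ m, H₀.card = m + 3 := ⟨H₀.card - 3, by omega⟩
  have hm4 : 4 ≤ m := by omega
  -- the bi-spanning part `𝓑` of both sides
  have hL : ((H₀.powersetCard 3).filter (fun Y => rk R Y = 3 ∧ rk R (H₀ \ Y ∪ {f, g}) = 3)).filter
      (fun Y => rk R (H₀ \ Y) = 3) = (H₀.powersetCard 3).filter (fun Y => rk R Y = 3 ∧ rk R (H₀ \ Y) = 3) := by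
    ext Y
    simp only [mem_filter, mem_powersetCard]
    constructor
    · rintro ⟨⟨hP, h1, _⟩, h3⟩
      exact ⟨hP, h1, h3⟩
    · rintro ⟨hP, h1, h3⟩
      refine ⟨⟨hP, h1, ?_⟩, h3⟩
      have h4 := rk_mono' (M := R) (subset_union_left (s₁ := H₀ \ Y) (s₂ := {f, g}))
      have h5 := hle3 (H₀ \ Y ∪ {f, g}) (union_subset (sdiff_subset.trans hH₀E) hT)
      omega
  have hU : ((H₀.powersetCard 3).filter (fun Y => rk R (Y ∪ {f, g}) = 3 ∧ rk R (H₀ \ Y) = 3)).filter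
      (fun Y => rk R Y = 3) = (H₀.powersetCard 3).filter (fun Y => rk R Y = 3 ∧ rk R (H₀ \ Y) = 3) := by
    ext Y
    simp only [mem_filter, mem_powersetCard]
    constructor
    · rintro ⟨⟨hP, _, h2⟩, h3⟩
      exact ⟨hP, h3, h2⟩
    · rintro ⟨hP, h1, h3⟩
      refine ⟨⟨hP, ?_, h3⟩, h1⟩
      have h4 := rk_mono' (M := R) (subset_union_left (s₁ := Y) (s₂ := {f, g}))
      have h5 := hle3 (Y ∪ {f, g}) (union_subset (hP.1.trans hH₀E) hT)
      omega
  have hLsplit := card_filter_add_card_filter_not (s := (H₀.powersetCard 3).filter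
      (fun Y => rk R Y = 3 ∧ rk R (H₀ \ Y ∪ {f, g}) = 3)) (fun Y => rk R (H₀ \ Y) = 3)
  have hUsplit := card_filter_add_card_filter_not (s := (H₀.powersetCard 3).filter
      (fun Y => rk R (Y ∪ {f, g}) = 3 ∧ rk R (H₀ \ Y) = 3)) (fun Y => rk R Y = 3)
  rw [hL] at hLsplit
  rw [hU] at hUsplit
  -- the double counting between `𝒟′` and `𝒰′`
  have hmain : (((H₀.powersetCard 3).filter (fun Y => rk R Y = 3 ∧ rk R (H₀ \ Y ∪ {f, g}) = 3)).filter
        (fun Y => ¬ rk R (H₀ \ Y) = 3)).card ≤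
      (((H₀.powersetCard 3).filter (fun Y => rk R (Y ∪ {f, g}) = 3 ∧ rk R (H₀ \ Y) = 3)).filter
        (fun Y => ¬ rk R Y = 3)).card := by
    have hc : 0 < (m - 1).choose 2 := Nat.choose_pos (by omega)
    refine Nat.le_of_mul_le_mul_right ?_ hc
    refine card_mul_le_card_mul (fun Y Z => Z ⊆ H₀ \ Y ∧ rk R Z = rk R (H₀ \ Y)) ?_ ?_
    · -- every `Y ∈ 𝒟′` has at least `C(m − 1, 2)` children
      intro Y hY
      simp only [mem_filter, mem_powersetCard] at hY
      obtain ⟨⟨⟨hYH, hY3⟩, hYr, hWT⟩, hW⟩ := hY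
      have hWcard : (H₀ \ Y).card = m := by rw [card_sdiff_of_subset hYH, hm, hY3]; omega
      have hWr : rk R (H₀ \ Y) ≤ 2 := by
        have := hle3 (H₀ \ Y) (sdiff_subset.trans hH₀E)
        omega
      have htri := choose_le_card_filter_rk_eq hll (sdiff_subset.trans hH₀E) (by omega) hWr
      rw [hWcard] at htri
      refine htri.trans (card_le_card ?_)
      intro Z hZ
      rw [mem_filter, mem_powersetCard] at hZ
      rw [mem_bipartiteAbove, mem_filter]
      obtain ⟨h1, h2⟩ := mem_units_of_subset_of_rk_eq hR3 hH₀E hT hYH hYr hWT hW hZ.1.1 hZ.1.2 hZ.2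
      exact ⟨⟨h1, h2⟩, hZ.1.1, hZ.2⟩
    · -- every `Z ∈ 𝒰′` has at most `C(m − 1, 2)` parents
      intro Z hZ
      simp only [mem_filter, mem_powersetCard] at hZ
      obtain ⟨⟨⟨hZH, hZ3⟩, _, _⟩, hZr⟩ := hZ
      have hZE : Z ⊆ gr R := hZH.trans hH₀E
      -- a point of `H₀` outside `cl(Z)`
      obtain ⟨o₀, ho₀, hcl⟩ : ∃ o₀ ∈ H₀, o₀ ∉ clF R Z := by
        by_contra hcon
        simp only [not_exists, not_and, not_not] at hcon
        have h1 := rk_mono' (M := R) (show H₀ ⊆ clF R Z from hcon)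
        rw [rk_clF] at h1
        have h2 := hle3 Z hZE
        omega
      have ho₀Z : o₀ ∉ Z := fun h => hcl (subset_clF hZE h)
      have hcard : (((H₀ \ Z).erase o₀).powersetCard 2).card = (m - 1).choose 2 := by
        rw [card_powersetCard, card_erase_of_mem (mem_sdiff.2 ⟨ho₀, ho₀Z⟩), card_sdiff_of_subset hZH, hm, hZ3]
        congr 1
      rw [← hcard]
      apply card_le_card_of_injOn (fun Y => Y.erase o₀)
      · intro Y hY
        rw [mem_coe, mem_bipartiteBelow, mem_filter, mem_filter, mem_powersetCard] at hY
        obtain ⟨⟨⟨⟨hYH, hY3⟩, _, _⟩, _⟩, hZY, hZr'⟩ := hY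
        have ho₀Y := mem_of_parent hH₀E hZY hZr' ho₀ hcl
        rw [mem_coe, mem_powersetCard]
        refine ⟨?_, by rw [card_erase_of_mem ho₀Y, hY3]⟩
        intro y hy
        rw [mem_erase] at hy ⊢
        refine ⟨hy.1, mem_sdiff.2 ⟨hYH hy.2, fun hz => ?_⟩⟩
        exact (mem_sdiff.1 (hZY hz)).2 hy.2
      · intro Y₁ hY₁ Y₂ hY₂ h
        rw [mem_coe, mem_bipartiteBelow, mem_filter, mem_filter, mem_powersetCard] at hY₁ hY₂
        obtain ⟨_, hZY₁, hZr₁⟩ := hY₁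
        obtain ⟨_, hZY₂, hZr₂⟩ := hY₂
        have h₁ := mem_of_parent hH₀E hZY₁ hZr₁ ho₀ hcl
        have h₂ := mem_of_parent hH₀E hZY₂ hZr₂ ho₀ hcl
        rw [← insert_erase h₁, ← insert_erase h₂]
        exact congrArg (insert o₀) h
  omega

end Core

end PercRepro.Cogirth
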